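import Mathlib
import Literature.Analysis.FluidPDE.KNSSTypeIRateSelection
import Summits.NavierStokesRegularity.NavierStokesRegularity.Theorems.EulerZoomLiouvillePowerGaugeEulerLiouvilleNeedleSphericalTonelli
import Summits.NavierStokesRegularity.NavierStokesRegularity.Theorems.EulerZoomLiouvillePowerGaugeEulerLiouvilleNeedleAxisymBand

/-!
# Needle portrait, axisymmetric case: THE SPHERE REDUCTION (ROUND-37 plate t38i)

Seat nsreg-p2 (`HOME/ns-regularity-ideate-p2/ROUND-37.md` §1 (K), v1.3); helper material for crux E
(`EulerZoomLiouville.PowerGaugeEulerLiouville`, stmt-NavierStokesRegularity-19832); nothing is wired into the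
LEAD's skeleton.  This plate turns a `C¹` axisymmetric field `V` on one sphere `S_t` (`t > 0`) into the
one-variable data of Lemma K (plate t38h, `sin_le_sqrt_mul_exp_of_level`):

* `meridianInflow V t θ = −⟪p, V p⟫`, `p = sphericalPt t θ 0` — the inflow observable along the meridian;
  `hasDerivAt_meridianInflow`: it is `C¹` in `θ` with derivative `meridianInflowDeriv`
  (t38d `hasDerivAt_sphericalPt_theta` + the product rule for `⟪·,·⟫`), `continuous_meridianInflowDeriv`;
* `meridianInflowDeriv_sq_le`: `f′(θ)² ≤ 2t²(t²‖DV(p)‖² + ‖V p‖²)`, hence the weighted Dirichlet budget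
  `integral_meridianInflowDeriv_sq_mul_sin_le`: `∫_0^π f′² sin ≤ 2t²(t²E + A)` with the sphere budgets
  `A = ∫_0^π ‖V p‖² sin θ dθ`, `E = ∫_0^π ‖DV p‖² sin θ dθ` (the inner integrals of t38d's spherical Tonelli);
* `cos_sub_cos_le_of_band`: a latitude band `[a, b]` on which `f ≥ m/2` has `cos a − cos b ≤ 4t²A/m²`
  (Chebyshev: `f² ≤ t²‖V p‖²`);
* `exists_rotZ_sphericalPt`: every `x` with `‖x‖ = t` is `rotZ ψ (sphericalPt t θ 0)` with `θ ∈ [0, π]` and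
  `cylRadius x = t sin θ`; so for axisymmetric `V` the fast condition `⟪x, V x⟫ ≤ −m` reads `f θ ≥ m`
  (`meridianInflow_ge_of_fast`).

With `m = γt²` these are exactly the hypotheses `hf`, `hf'c`, `hD`, `hcheb` of t38h; the assembled
per-sphere statement («a γ-fast point of `S_t` has `cylRadius ≤ t√(2πμ)·e^{−Λ}`») and the good-radii
packaging into the (R)-interface `hthin` of `…NeedleRace` are the next plate (t38j).
Namespace `…PowerGaugeEulerLiouville.NeedleAxisymBand` (shared with t38a/t38h), new names only.
-/

open MeasureTheory Set Real intervalIntegral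
open Literature.Analysis Literature.Analysis.FluidPDE
open Summit.NavierStokesRegularity.NavierStokesRegularity.Theorems.PowerGaugeEulerLiouville.NeedleSphericalTonelli

set_option linter.dupNamespace false

namespace Summit.NavierStokesRegularity.NavierStokesRegularity.Theorems.PowerGaugeEulerLiouville.NeedleAxisymBand

-- (the plate's `local notation "E3"` was spelled out at the gate by the firing seat: notation in Theorems files routes to review)

variable {V : (EuclideanSpace ℝ (Fin 3)) → (EuclideanSpace ℝ (Fin 3))} {V' : (EuclideanSpace ℝ (Fin 3)) → (EuclideanSpace ℝ (Fin 3)) →L[ℝ] (EuclideanSpace ℝ (Fin 3))}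

/-! ### 1. The meridian inflow profile and its derivative -/

/-- The inflow observable along the meridian `φ = 0` of the sphere `S_t`:
`meridianInflow V t θ = −⟪p, V p⟫`, `p = sphericalPt t θ 0` (a `γ`-fast point has it `≥ γ t²`). -/
noncomputable def meridianInflow (V : (EuclideanSpace ℝ (Fin 3)) → (EuclideanSpace ℝ (Fin 3))) (t θ : ℝ) : ℝ :=
  -inner ℝ (sphericalPt t θ 0) (V (sphericalPt t θ 0))

/-- The `θ`-derivative of `meridianInflow`: `−(⟪p, DV(p) τ⟫ + ⟪τ, V p⟫)`, `τ = ∂_θ p`. -/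
noncomputable def meridianInflowDeriv (V : (EuclideanSpace ℝ (Fin 3)) → (EuclideanSpace ℝ (Fin 3))) (V' : (EuclideanSpace ℝ (Fin 3)) → (EuclideanSpace ℝ (Fin 3)) →L[ℝ] (EuclideanSpace ℝ (Fin 3))) (t θ : ℝ) : ℝ :=
  -(inner ℝ (sphericalPt t θ 0) (V' (sphericalPt t θ 0) (sphericalTangentTheta t θ 0)) +
    inner ℝ (sphericalTangentTheta t θ 0) (V (sphericalPt t θ 0)))

/-- The meridian inflow profile `θ ↦ −⟪p(θ), V(p(θ))⟫`, `p(θ) = sphericalPt t θ 0`, is differentiable with derivative `meridianInflowDeriv`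
(chain rule along the meridian arc). [folklore] -/
theorem hasDerivAt_meridianInflow (hV : ∀ y, HasFDerivAt V (V' y) y) (t θ : ℝ) :
    HasDerivAt (meridianInflow V t) (meridianInflowDeriv V V' t θ) θ := by
  have hp := hasDerivAt_sphericalPt_theta t θ 0
  have hVp : HasDerivAt (fun θ => V (sphericalPt t θ 0))
      (V' (sphericalPt t θ 0) (sphericalTangentTheta t θ 0)) θ :=
    (hV (sphericalPt t θ 0)).comp_hasDerivAt θ hp
  have h := (hp.inner ℝ hVp).neg
  exact h

/-- Continuity of `θ ↦ sphericalPt t θ φ`. -/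
theorem continuous_sphericalPt_theta (t φ : ℝ) : Continuous fun θ : ℝ => sphericalPt t θ φ :=
  (continuous_sphericalPt_left φ).comp (continuous_const.prodMk continuous_id)

/-- Continuity of `θ ↦ sphericalTangentTheta t θ φ`. -/
theorem continuous_sphericalTangentTheta_theta (t φ : ℝ) :
    Continuous fun θ : ℝ => sphericalTangentTheta t θ φ := by
  refine (PiLp.continuous_toLp 2 _).comp (continuous_pi fun i => ?_)
  fin_cases i
  · exact (continuous_const.mul Real.continuous_cos).mul continuous_const
  · exact (continuous_const.mul Real.continuous_cos).mul continuous_const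
  · exact (continuous_const.mul Real.continuous_sin).neg

/-- The derivative of the meridian inflow profile is continuous (`V` is `C¹` with continuous `V'`). [folklore] -/
theorem continuous_meridianInflowDeriv (hV : ∀ y, HasFDerivAt V (V' y) y) (hV'c : Continuous V')
    (t : ℝ) : Continuous (meridianInflowDeriv V V' t) := by
  have hVc : Continuous V := continuous_iff_continuousAt.2 fun y => (hV y).continuousAt
  have hp := continuous_sphericalPt_theta t 0
  have hτ := continuous_sphericalTangentTheta_theta t 0
  unfold meridianInflowDeriv
  refine (Continuous.add ?_ ?_).neg
  · exact hp.inner (((hV'c.comp hp).clm_apply hτ))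
  · exact hτ.inner (hVc.comp hp)

/-- `f′(θ)² ≤ 2t²(t²‖DV(p)‖² + ‖V p‖²)` (`‖p‖ = ‖∂_θ p‖ = t`). -/
theorem meridianInflowDeriv_sq_le (V : (EuclideanSpace ℝ (Fin 3)) → (EuclideanSpace ℝ (Fin 3))) (V' : (EuclideanSpace ℝ (Fin 3)) → (EuclideanSpace ℝ (Fin 3)) →L[ℝ] (EuclideanSpace ℝ (Fin 3))) {t : ℝ} (ht : 0 < t) (θ : ℝ) :
    meridianInflowDeriv V V' t θ ^ 2 ≤
      2 * t ^ 2 * (t ^ 2 * ‖V' (sphericalPt t θ 0)‖ ^ 2 + ‖V (sphericalPt t θ 0)‖ ^ 2) := by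
  have hnp : ‖sphericalPt t θ 0‖ = t := by rw [norm_sphericalPt, abs_of_pos ht]
  have hnτ : ‖sphericalTangentTheta t θ 0‖ = t := by rw [norm_sphericalTangentTheta, abs_of_pos ht]
  have h1 : |inner ℝ (sphericalPt t θ 0) (V' (sphericalPt t θ 0) (sphericalTangentTheta t θ 0))| ≤
      t * (t * ‖V' (sphericalPt t θ 0)‖) := by
    refine (abs_real_inner_le_norm _ _).trans ?_
    rw [hnp]
    refine mul_le_mul_of_nonneg_left ?_ ht.le
    calc ‖V' (sphericalPt t θ 0) (sphericalTangentTheta t θ 0)‖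
        ≤ ‖V' (sphericalPt t θ 0)‖ * ‖sphericalTangentTheta t θ 0‖ := ContinuousLinearMap.le_opNorm _ _
      _ = t * ‖V' (sphericalPt t θ 0)‖ := by rw [hnτ, mul_comm]
  have h2 : |inner ℝ (sphericalTangentTheta t θ 0) (V (sphericalPt t θ 0))| ≤
      t * ‖V (sphericalPt t θ 0)‖ := by
    refine (abs_real_inner_le_norm _ _).trans ?_
    rw [hnτ]
  set a := inner ℝ (sphericalPt t θ 0) (V' (sphericalPt t θ 0) (sphericalTangentTheta t θ 0))
  set b := inner ℝ (sphericalTangentTheta t θ 0) (V (sphericalPt t θ 0))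
  set X := ‖V' (sphericalPt t θ 0)‖
  set Y := ‖V (sphericalPt t θ 0)‖
  have hsq : meridianInflowDeriv V V' t θ ^ 2 = (a + b) ^ 2 := by
    unfold meridianInflowDeriv; rw [neg_sq]
  rw [hsq]
  have ha : a ^ 2 ≤ (t * (t * X)) ^ 2 := sq_le_sq' (abs_le.1 h1).1 (abs_le.1 h1).2
  have hb : b ^ 2 ≤ (t * Y) ^ 2 := sq_le_sq' (abs_le.1 h2).1 (abs_le.1 h2).2
  nlinarith [sq_nonneg (a - b)]

/-! ### 2. The two sphere budgets of Lemma K -/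

/-- **Weighted Dirichlet budget of the meridian profile**:
`∫_0^π f′(θ)² sin θ dθ ≤ 2t²(t²·(∫_0^π ‖DV p‖² sin) + ∫_0^π ‖V p‖² sin)`. -/
theorem integral_meridianInflowDeriv_sq_mul_sin_le (hV : ∀ y, HasFDerivAt V (V' y) y)
    (hV'c : Continuous V') {t : ℝ} (ht : 0 < t) :
    ∫ θ in (0 : ℝ)..π, meridianInflowDeriv V V' t θ ^ 2 * Real.sin θ ≤
      2 * t ^ 2 * (t ^ 2 * (∫ θ in (0 : ℝ)..π, ‖V' (sphericalPt t θ 0)‖ ^ 2 * Real.sin θ) +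
        ∫ θ in (0 : ℝ)..π, ‖V (sphericalPt t θ 0)‖ ^ 2 * Real.sin θ) := by
  have hVc : Continuous V := continuous_iff_continuousAt.2 fun y => (hV y).continuousAt
  have hp := continuous_sphericalPt_theta t 0
  have hXc : Continuous fun θ : ℝ => ‖V' (sphericalPt t θ 0)‖ ^ 2 * Real.sin θ :=
    ((hV'c.comp hp).norm.pow 2).mul Real.continuous_sin
  have hYc : Continuous fun θ : ℝ => ‖V (sphericalPt t θ 0)‖ ^ 2 * Real.sin θ :=
    ((hVc.comp hp).norm.pow 2).mul Real.continuous_sin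
  have hfc := continuous_meridianInflowDeriv hV hV'c t
  calc ∫ θ in (0 : ℝ)..π, meridianInflowDeriv V V' t θ ^ 2 * Real.sin θ
      ≤ ∫ θ in (0 : ℝ)..π, 2 * t ^ 2 * (t ^ 2 * (‖V' (sphericalPt t θ 0)‖ ^ 2 * Real.sin θ) +
          ‖V (sphericalPt t θ 0)‖ ^ 2 * Real.sin θ) := by
        refine intervalIntegral.integral_mono_on Real.pi_pos.le
          (((hfc.pow 2).mul Real.continuous_sin).intervalIntegrable _ _)
          ((continuous_const.mul ((continuous_const.mul hXc).add hYc)).intervalIntegrable _ _)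
          fun θ hθ => ?_
        have hs : 0 ≤ Real.sin θ := Real.sin_nonneg_of_mem_Icc hθ
        have := meridianInflowDeriv_sq_le V V' ht θ
        nlinarith
    _ = 2 * t ^ 2 * (t ^ 2 * (∫ θ in (0 : ℝ)..π, ‖V' (sphericalPt t θ 0)‖ ^ 2 * Real.sin θ) +
          ∫ θ in (0 : ℝ)..π, ‖V (sphericalPt t θ 0)‖ ^ 2 * Real.sin θ) := by
        rw [intervalIntegral.integral_const_mul,
          intervalIntegral.integral_add ((hXc.const_mul (t ^ 2)).intervalIntegrable _ _)
            (hYc.intervalIntegrable _ _),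
          intervalIntegral.integral_const_mul]

/-- `f(θ)² ≤ t² ‖V p‖²`. -/
theorem meridianInflow_sq_le (V : (EuclideanSpace ℝ (Fin 3)) → (EuclideanSpace ℝ (Fin 3))) {t : ℝ} (ht : 0 < t) (θ : ℝ) :
    meridianInflow V t θ ^ 2 ≤ t ^ 2 * ‖V (sphericalPt t θ 0)‖ ^ 2 := by
  have hnp : ‖sphericalPt t θ 0‖ = t := by rw [norm_sphericalPt, abs_of_pos ht]
  have h := abs_real_inner_le_norm (sphericalPt t θ 0) (V (sphericalPt t θ 0))
  rw [hnp] at h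
  unfold meridianInflow
  rw [neg_sq, ← mul_pow]
  exact sq_le_sq' (abs_le.1 h).1 (abs_le.1 h).2

/-- **Chebyshev budget**: a latitude band `[a, b] ⊆ [0, π]` on which `meridianInflow ≥ m/2` (`m > 0`) has
`cos a − cos b ≤ 4 t² (∫_0^π ‖V p‖² sin) / m²`. -/
theorem cos_sub_cos_le_of_band (hV : ∀ y, HasFDerivAt V (V' y) y) {t m : ℝ} (ht : 0 < t) (hm : 0 < m)
    {a b : ℝ} (ha : 0 ≤ a) (hab : a ≤ b) (hb : b ≤ π)
    (hband : ∀ θ ∈ Icc a b, m / 2 ≤ meridianInflow V t θ) :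
    Real.cos a - Real.cos b ≤
      4 * t ^ 2 * (∫ θ in (0 : ℝ)..π, ‖V (sphericalPt t θ 0)‖ ^ 2 * Real.sin θ) / m ^ 2 := by
  have hVc : Continuous V := continuous_iff_continuousAt.2 fun y => (hV y).continuousAt
  have hp := continuous_sphericalPt_theta t 0
  have hYc : Continuous fun θ : ℝ => ‖V (sphericalPt t θ 0)‖ ^ 2 * Real.sin θ :=
    ((hVc.comp hp).norm.pow 2).mul Real.continuous_sin
  -- `(m/2)² (cos a − cos b) = ∫_a^b (m/2)² sin ≤ ∫_a^b t² ‖V p‖² sin ≤ t² ∫_0^π ‖V p‖² sin`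
  have h1 : ∫ θ in a..b, (m / 2) ^ 2 * Real.sin θ ≤ ∫ θ in a..b, t ^ 2 * (‖V (sphericalPt t θ 0)‖ ^ 2 *
      Real.sin θ) := by
    refine intervalIntegral.integral_mono_on hab
      ((continuous_const.mul Real.continuous_sin).intervalIntegrable _ _)
      ((continuous_const.mul hYc).intervalIntegrable _ _) fun θ hθ => ?_
    have hs : 0 ≤ Real.sin θ := Real.sin_nonneg_of_mem_Icc ⟨ha.trans hθ.1, hθ.2.trans hb⟩
    have hf := hband θ hθ
    have hf2 : (m / 2) ^ 2 ≤ meridianInflow V t θ ^ 2 := pow_le_pow_left₀ (by linarith) hf 2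
    have := meridianInflow_sq_le V ht θ
    nlinarith
  have h2 : ∫ θ in a..b, ‖V (sphericalPt t θ 0)‖ ^ 2 * Real.sin θ ≤
      ∫ θ in (0 : ℝ)..π, ‖V (sphericalPt t θ 0)‖ ^ 2 * Real.sin θ := by
    refine intervalIntegral.integral_mono_interval ha hab hb ?_ (hYc.intervalIntegrable _ _)
    refine (ae_restrict_mem measurableSet_Ioc).mono fun θ hθ => ?_
    exact mul_nonneg (sq_nonneg _) (Real.sin_nonneg_of_mem_Icc ⟨hθ.1.le, hθ.2⟩)
  rw [intervalIntegral.integral_const_mul, integral_sin, intervalIntegral.integral_const_mul] at h1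
  have hm2 : 0 < m ^ 2 := by positivity
  rw [le_div_iff₀ hm2]
  have : (m / 2) ^ 2 = m ^ 2 / 4 := by ring
  rw [this] at h1
  nlinarith [h1, h2, sq_nonneg t, mul_nonneg (sq_nonneg t) (sub_nonneg.2 h2)]

/-! ### 3. Every point of the sphere is a rotated meridian point -/

/-- `‖x‖² = cylRadius x ² + (x 2)²`. -/
theorem norm_sq_eq_cylRadius_sq_add (x : (EuclideanSpace ℝ (Fin 3))) : ‖x‖ ^ 2 = cylRadius x ^ 2 + x 2 ^ 2 := by
  rw [EuclideanSpace.norm_sq_eq, Fin.sum_univ_three, cylRadius_sq]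
  simp only [Real.norm_eq_abs, sq_abs]

/-- Every `x ∈ S_t` (`t > 0`) is `rotZ ψ (sphericalPt t θ 0)` with `θ = arccos (x₂/t) ∈ [0, π]`, and
`cylRadius x = t sin θ`. -/
theorem exists_rotZ_sphericalPt {t : ℝ} (ht : 0 < t) {x : (EuclideanSpace ℝ (Fin 3))} (hx : ‖x‖ = t) :
    ∃ θ ∈ Icc (0 : ℝ) π, ∃ ψ : ℝ, rotZ ψ (sphericalPt t θ 0) = x ∧ cylRadius x = t * Real.sin θ := by
  obtain ⟨ψ, hψ⟩ := exists_rotZ_eq_single_add_smul x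
  set θ := Real.arccos (x 2 / t) with hθ
  have hx2 : |x 2| ≤ t := hx ▸ abs_apply_le_norm x 2
  have hcos : Real.cos θ = x 2 / t := by
    rw [hθ, Real.cos_arccos] <;>
      [rw [le_div_iff₀ ht]; rw [div_le_iff₀ ht]] <;> linarith [(abs_le.1 hx2).1, (abs_le.1 hx2).2]
  have hsin : t * Real.sin θ = cylRadius x := by
    rw [hθ, Real.sin_arccos]
    have h1 : 1 - (x 2 / t) ^ 2 = cylRadius x ^ 2 / t ^ 2 := by
      field_simp
      nlinarith [norm_sq_eq_cylRadius_sq_add x, hx]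
    rw [h1, Real.sqrt_div' _ (sq_nonneg t), Real.sqrt_sq (cylRadius_nonneg x), Real.sqrt_sq ht.le]
    field_simp
  have hpt : sphericalPt t θ 0 = EuclideanSpace.single 2 (x 2) + cylRadius x • EuclideanSpace.single 0 1 := by
    ext i
    fin_cases i
    · simp [hsin]
    · simp
    · simp
      rw [hcos]
      field_simp
  refine ⟨θ, ⟨Real.arccos_nonneg _, Real.arccos_le_pi _⟩, -ψ, ?_, hsin.symm⟩
  rw [hpt, ← hψ, ← rotZ_add, neg_add_cancel, rotZ_zero]

/-- For axisymmetric `V`, the fast condition at any `x ∈ S_t` is a condition on the meridian profile: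
`⟪x, V x⟫ ≤ −m` gives a latitude `θ ∈ [0, π]` with `meridianInflow V t θ ≥ m` and `cylRadius x = t sin θ`. -/
theorem meridianInflow_ge_of_fast (hax : IsAxisymmetric V) {t : ℝ} (ht : 0 < t) {x : (EuclideanSpace ℝ (Fin 3))} (hx : ‖x‖ = t)
    {m : ℝ} (hfast : inner ℝ x (V x) ≤ -m) :
    ∃ θ ∈ Icc (0 : ℝ) π, m ≤ meridianInflow V t θ ∧ cylRadius x = t * Real.sin θ := by
  obtain ⟨θ, hθ, ψ, hrot, hcyl⟩ := exists_rotZ_sphericalPt ht hx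
  refine ⟨θ, hθ, ?_, hcyl⟩
  have hsc : inner ℝ (rotZ ψ (sphericalPt t θ 0)) (V (rotZ ψ (sphericalPt t θ 0))) =
      inner ℝ (sphericalPt t θ 0) (V (sphericalPt t θ 0)) :=
    isAxisymmetricScalar_inner_self hax ψ (sphericalPt t θ 0)
  rw [hrot] at hsc
  unfold meridianInflow
  linarith

end Summit.NavierStokesRegularity.NavierStokesRegularity.Theorems.PowerGaugeEulerLiouville.NeedleAxisymBand
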